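import Literature.Geometry.Riemannian.RicciDeTurckFlow
import Literature.Geometry.Lorentzian.CurvatureNaturality
import Literature.Geometry.Lorentzian.LeviCivitaCurvature
import Literature.Geometry.Lorentzian.MetricNormSq
import HarnessLib

/-!
# Naturality of the DeTurck vector field and of the Ricci–DeTurck operator under local
# diffeomorphisms; the inverse extended chart as a local diffeomorphism
(topic `Geometry/Riemannian`)

Fourth layer of the DeTurck decomposition of the named fact
`Literature.Geometry.Riemannian.ricciFlow_uniqueness` (`RicciFlow.lean`; Hamilton 1982,
Thm. 5.1; Topping 2006, Thm. 5.2.2). The remaining analytic input (RU) of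
`RicciDeTurckReduction.lean` — uniqueness for the Ricci–DeTurck flow
`∂ₜg = -2 Ric(g) + ℒ_{W(g,∇̃)} g` on a closed manifold (Andrews–Hopper 2011, §5.4.2, Step 1) — is
to be proved by the scalar maximum principle (`RicciFlowScalarMaximumPrinciple.lean`) applied
to `|g₁ - g₂|²`, with the differential inequality computed in charts, where the Ricci–DeTurck
operator has the strictly parabolic form of `RicciDeTurckCoord.lean` (on `U : Opens E`). This
file supplies the transport between a manifold `M` and a chart: the DIFFEOMORPHISM INVARIANCE
of the objects of `RicciDeTurckFlow.lean` under an equidimensional immersion `Φ : N → M`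
(O'Neill 1983, Ch. 3, Prop. 3.59: local isometries preserve the Levi-Civita connection, hence
everything built from it), and the inverse extended chart `Φ = (extChartAt I x₁)⁻¹` as such an
immersion from the open subset `chartTarget I x₁ ⊆ E`. Everything is proved; no named fact and
no `sorry` is introduced.

## Contents (all proved)

Naturality under `Φ : N → M` (smooth, injective differentials, `dim N = dim M`; pullback
metric `Φ^* g = g.comap …` of `Isometry.lean`, pulled-back fields `Φ^* Y = mpullback`):
* `trace_comap_eq`, `normSq_comap_eq` — the metric trace and the metric square norm of a
  bilinear form are natural (`tr_{Φ^*g} Φ^*B = tr_g B`, `|Φ^*B|²_{Φ^*g} = |B|²_g`);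
* `difference_comap_apply` — the difference tensor `∇^{Φ^*g} - ∇^{Φ^*h}` is
  `(dΦ)⁻¹ ∘ (∇^g - ∇^h) ∘ (dΦ × dΦ)` (Mathlib's `CovariantDerivative.difference`,
  `leviCivita_comap_mpullback_apply` of `ConnectionNaturality.lean`);
* `val_deTurckField_comap`, **`deTurckField_comap`** — the DeTurck vector field
  `W = gᵖ𐞥(Γ_{pq} - Γ̃_{pq})` of `(Φ^*g, Φ^*h)` is the pullback `Φ^* W` of that of `(g, h)`
  (Andrews–Hopper 2011, §5.4.1: "a globally well defined vector field");
* `lieDerivMetric_comap_mpullback` — `ℒ_{Φ^*W}(Φ^*g) = Φ^*(ℒ_W g)` through the connections;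
* **`rdt_rhs_comap`** — `-2 Ric_{Φ^*g} + ℒ_{W'}(Φ^*g) = Φ^*(-2 Ric_g + ℒ_W g)` (with
  `ricci_comap_apply` of `CurvatureNaturality.lean`);
* `difference_eq_of_isLeviCivita_right`, **`rdt_rhs_eq_of_isLeviCivita`** — the right-hand side
  of the Ricci–DeTurck equation written, as in `IsRicciDeTurckFlow`, with arbitrary Levi-Civita
  witnesses `cov` of `g` and `bg` of `h`, equals the one written with `g.leviCivita`,
  `h.leviCivita` (`IsLeviCivita.ricci_eq_ricci`, `deTurckField_eq_of_isLeviCivita`,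
  `IsLeviCivita.eq_leviCivita_holds`).

The chart (`I.Boundaryless`, so that chart targets are open in `E`):
* `chartTarget I x₁ : Opens E`, `chartInv I x₁ : chartTarget I x₁ → M` (the inverse extended
  chart), `contMDiff_chartInv`, `extChartAt_chartInv`, `chartInv_extChartAt`,
  `mfderiv_extChartAt_comp_mfderiv_chartInv`, `injective_mfderiv_chartInv`,
  `mfderiv_extChartAt_chartInv_apply`;
* `mdifferentiableAt_section_of_chartRepr` — a vector field is a differentiable section of `TM`
  at a point of the chart domain as soon as its representative `D(extChartAt) ∘ W` read through
  the chart is differentiable (Mathlib's `Trivialization.mdifferentiableAt_section_iff`,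
  `TangentBundle.continuousLinearMapAt_trivializationAt`);
* `chartPullback I g x₁ = Φ^* g` on `chartTarget I x₁` (`val_chartPullback_apply`,
  `chartPullback_pos`, `normSq_chartPullback_eq`, `trace_chartPullback_eq`);
* **`IsRicciDeTurckFlow.hasDerivWithinAt_chartPullback`** — a Ricci–DeTurck flow `(k, cov)` on
  `M` relative to a Levi-Civita background of `h`, read in the chart at `x₁`, satisfies at each
  point `u` of the chart target (where the DeTurck field is differentiable) the Ricci–DeTurck
  equation of the pulled-back pair `(Φ^*(k t), Φ^*h)` — the form to which
  `RicciDeTurckCoord.rdt_rhs_eq_coord` applies.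

## References

* B. O'Neill, *Semi-Riemannian geometry*, Academic Press 1983, Ch. 3, Prop. 3.59,
  Cor. 3.60–3.61, pp. 60–61, pp. 90–91. [ONeill1983]
* B. Andrews, C. Hopper, *The Ricci flow in Riemannian geometry*, LNM 2011, Springer 2011,
  §5.4.1, (5.7); §5.4.2, Step 1 and (5.10). [AndrewsHopper2011]
* P. Topping, *Lectures on the Ricci flow*, LMS LNS 325 (2006), §5.2. [Topping2006]
-/

noncomputable section

open Bundle Set Function Filter FiberBundle VectorField ContinuousLinearMap TopologicalSpace
open scoped Manifold ContDiff Topology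

namespace Literature.Geometry.Riemannian

open Lorentzian Lorentzian.PseudoRiemannianMetric

/-! ### Naturality under an equidimensional immersion `Φ : N → M` -/

section Naturality

variable {E : Type*} [NormedAddCommGroup E] [NormedSpace ℝ E] {H : Type*} [TopologicalSpace H]
  {I : ModelWithCorners ℝ E H} {M : Type*} [TopologicalSpace M] [ChartedSpace H M]
  [IsManifold I ∞ M]
  {E' : Type*} [NormedAddCommGroup E'] [NormedSpace ℝ E'] {H' : Type*} [TopologicalSpace H']
  {I' : ModelWithCorners ℝ E' H'} {N : Type*} [TopologicalSpace N] [ChartedSpace H' N]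
  [IsManifold I' ∞ N]
  [FiniteDimensional ℝ E] [FiniteDimensional ℝ E'] [CompleteSpace E] [CompleteSpace E']
  (g h : PseudoRiemannianMetric I ∞ E (TangentSpace I : M → Type _))
  {Φ : N → M} (hpb : contMDiff_pullbackBilin I M I' N ∞) (hΦ : ContMDiff I' I (∞ + 1) Φ)
  (hΦ' : ∀ u, Function.Injective (mfderiv I' I Φ u))
  (hdim : Module.finrank ℝ E' = Module.finrank ℝ E)

omit [CompleteSpace E] [CompleteSpace E'] in
include hΦ' in
/-- **The metric trace is natural**: if a bilinear form `B'` on `T_u N` is the pullback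
`B' (v, w) = B (dΦ v, dΦ w)` of a form `B` on `T_{Φ u} M`, then `tr_{Φ^*g} B' = tr_g B` (expand
both traces in the bases `β` and `dΦ β`, which have the same Gram matrices;
`trace_eq_sum_gram_inv`). O'Neill 1983, Ch. 3, pp. 60–61 and Prop. 3.59.
[cite: ONeill1983, Ch. 3, Prop. 3.59] -/
theorem trace_comap_eq (u : N) (B' : LinearMap.BilinForm ℝ (TangentSpace I' u))
    (B : LinearMap.BilinForm ℝ (TangentSpace I (Φ u)))
    (hB : ∀ v w, B' v w = B (mfderiv I' I Φ u v) (mfderiv I' I Φ u w)) :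
    (g.comap hpb Φ hΦ hΦ' hdim).trace u B' = g.trace (Φ u) B := by
  classical
  haveI : FiniteDimensional ℝ (TangentSpace I' u) := inferInstanceAs (FiniteDimensional ℝ E')
  set e := mfderivEquivOfInjective (I := I) (I' := I') Φ u (hΦ' u) hdim with he
  set β := Module.finBasis ℝ (TangentSpace I' u) with hβ
  set β' : Module.Basis (Fin (Module.finrank ℝ (TangentSpace I' u))) ℝ (TangentSpace I (Φ u)) :=
    β.map e with hβ'
  rw [trace_eq_sum_gram_inv (g.comap hpb Φ hΦ hΦ' hdim) u β, trace_eq_sum_gram_inv g (Φ u) β']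
  have hgram : (Matrix.of fun i j ↦ (g.comap hpb Φ hΦ hΦ' hdim).val u (β i) (β j)) =
      Matrix.of fun i j ↦ g.val (Φ u) (β' i) (β' j) := by
    ext i j
    simp only [Matrix.of_apply, hβ', Module.Basis.map_apply, val_comap, pullbackBilin_apply]
    rfl
  have hB' : ∀ i j, B' (β i) (β j) = B (β' i) (β' j) := fun i j ↦ by
    rw [hB, hβ', Module.Basis.map_apply, Module.Basis.map_apply]
    rfl
  rw [hgram]
  simp only [hB']

omit [CompleteSpace E] [CompleteSpace E'] in
include hΦ' hdim in
/-- **The metric square norm is natural**: if `B' (v, w) = B (dΦ v, dΦ w)` then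
`|B'|²_{Φ^*g} = |B|²_g` (both square norms are sums of squares of components in the orthogonal
bases `e` of `T_{Φ u} M` and `(dΦ)⁻¹ e` of `T_u N`, `normSq_eq_sum_sq`). O'Neill 1983, Ch. 3,
pp. 60–61 and Prop. 3.59. [cite: ONeill1983, Ch. 3, Prop. 3.59] -/
theorem normSq_comap_eq (u : N) (B' : LinearMap.BilinForm ℝ (TangentSpace I' u))
    (B : LinearMap.BilinForm ℝ (TangentSpace I (Φ u)))
    (hB : ∀ v w, B' v w = B (mfderiv I' I Φ u v) (mfderiv I' I Φ u w)) :
    (g.comap hpb Φ hΦ hΦ' hdim).normSq u B' = g.normSq (Φ u) B := by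
  classical
  haveI : FiniteDimensional ℝ (TangentSpace I' u) := inferInstanceAs (FiniteDimensional ℝ E')
  haveI : FiniteDimensional ℝ (TangentSpace I (Φ u)) := inferInstanceAs (FiniteDimensional ℝ E)
  set eq := mfderivEquivOfInjective (I := I) (I' := I') Φ u (hΦ' u) hdim with heq
  obtain ⟨e, he, hc⟩ := g.exists_isOrthoᵢ_basis (Φ u)
  set e₀ : Module.Basis (Fin (Module.finrank ℝ (TangentSpace I (Φ u)))) ℝ (TangentSpace I' u) :=
    e.map eq.symm with he₀
  have hmap : ∀ i, mfderiv I' I Φ u (e₀ i) = e i := fun i ↦ by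
    rw [he₀, Module.Basis.map_apply]
    exact eq.apply_symm_apply (e i)
  have hval : ∀ i j, (g.comap hpb Φ hΦ hΦ' hdim).val u (e₀ i) (e₀ j) = g.val (Φ u) (e i) (e j) :=
    fun i j ↦ by rw [val_comap, pullbackBilin_apply, hmap, hmap]
  have he₀o : ((g.comap hpb Φ hΦ hΦ' hdim).toBilinForm u).IsOrthoᵢ e₀ := by
    intro i j hij
    have h := he hij
    change (g.comap hpb Φ hΦ hΦ' hdim).toBilinForm u (e₀ i) (e₀ j) = 0
    rw [PseudoRiemannianMetric.toBilinForm_apply, hval]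
    exact h
  have hc₀ : ∀ i, (g.comap hpb Φ hΦ hΦ' hdim).val u (e₀ i) (e₀ i) ≠ 0 := fun i ↦ by
    rw [hval]
    exact hc i
  rw [(g.comap hpb Φ hΦ hΦ' hdim).normSq_eq_sum_sq u e₀ he₀o hc₀ B',
    g.normSq_eq_sum_sq (Φ u) e he hc B]
  simp only [hval, hB, hmap]

omit [CompleteSpace E] in
include hΦ' in
/-- **Naturality of the difference tensor of the Levi-Civita connections** of two smooth metrics
`g`, `h` on `M`: for the pullbacks along `Φ`,
`(∇^{Φ^*g} - ∇^{Φ^*h})_u (Y₀)(X₀) = (dΦ_u)⁻¹ (∇^g - ∇^h)_{Φ u}(dΦ Y₀)(dΦ X₀)` (Mathlib's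
`difference` evaluated on the pullback of the canonical extension of `dΦ Y₀`, and naturality of
both connections, `leviCivita_comap_mpullback_apply`). [cite: ONeill1983, Ch. 3, Prop. 3.59] -/
theorem difference_comap_apply [g.HasLeviCivita] [h.HasLeviCivita]
    [(g.comap hpb Φ hΦ hΦ' hdim).HasLeviCivita] [(h.comap hpb Φ hΦ hΦ' hdim).HasLeviCivita]
    (u : N) (Y₀ X₀ : TangentSpace I' u) :
    (g.comap hpb Φ hΦ hΦ' hdim).leviCivita.difference (h.comap hpb Φ hΦ hΦ' hdim).leviCivita u
        Y₀ X₀ =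
      (mfderiv I' I Φ u).inverse (g.leviCivita.difference h.leviCivita (Φ u)
        (mfderiv I' I Φ u Y₀) (mfderiv I' I Φ u X₀)) := by
  have h2 : (2 : ℕ∞ω) ≤ ∞ := WithTop.coe_le_coe.mpr le_top
  have hΦs : ContMDiff I' I ∞ Φ := hΦ.of_le le_self_add
  have hinv : (mfderiv I' I Φ u).IsInvertible := isInvertible_mfderiv_of_injective hdim (hΦ' u)
  set Y' : Π x : M, TangentSpace I x := FiberBundle.extend E (mfderiv I' I Φ u Y₀) with hY'
  have hY'd : MDiffAt (T% Y') (Φ u) := mdifferentiableAt_extend ..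
  have hpull : MDiffAt (T% (mpullback I' I Φ Y')) u :=
    hY'd.mpullback_vectorField (hΦs u) hinv h2
  have hval : mpullback I' I Φ Y' u = Y₀ := mpullback_extend_mfderiv_apply hΦ' hdim u Y₀
  have hN := IsCovariantDerivativeOn.difference_apply (x := u)
    (g.comap hpb Φ hΦ hΦ' hdim).leviCivita.isCovariantDerivativeOnUniv
    (h.comap hpb Φ hΦ hΦ' hdim).leviCivita.isCovariantDerivativeOnUniv
    (σ := mpullback I' I Φ Y') (by trivial) hpull
  rw [hval] at hN
  have hM := IsCovariantDerivativeOn.difference_apply (x := Φ u)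
    g.leviCivita.isCovariantDerivativeOnUniv h.leviCivita.isCovariantDerivativeOnUniv
    (σ := Y') (by trivial) hY'd
  rw [hY', FiberBundle.extend_apply_self, ← hY'] at hM
  simp only [CovariantDerivative.difference]
  rw [hN, hM, _root_.sub_apply, _root_.sub_apply, map_sub,
    g.leviCivita_comap_mpullback_apply hpb hΦ hΦ' hdim hY'd X₀,
    h.leviCivita_comap_mpullback_apply hpb hΦ hΦ' hdim hY'd X₀]

omit [CompleteSpace E] in
include hΦ' in
/-- **Naturality of the metric dual of the DeTurck field**:
`(Φ^*g)_u (W', Z₀) = g_{Φ u} (W, dΦ Z₀)` for the DeTurck fields `W'` of `(Φ^*g, Φ^*h)` and `W` of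
`(g, h)` (`W = tr_g (∇^g - ∇^h)`; `trace_comap_eq` and `difference_comap_apply`).
[cite: AndrewsHopper2011, §5.4.1, (5.7)] -/
theorem val_deTurckField_comap [g.HasLeviCivita] [h.HasLeviCivita]
    [(g.comap hpb Φ hΦ hΦ' hdim).HasLeviCivita] [(h.comap hpb Φ hΦ hΦ' hdim).HasLeviCivita]
    (u : N) (Z₀ : TangentSpace I' u) :
    (g.comap hpb Φ hΦ hΦ' hdim).val u
        (deTurckField (g.comap hpb Φ hΦ hΦ' hdim) (g.comap hpb Φ hΦ hΦ' hdim).leviCivita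
          (h.comap hpb Φ hΦ hΦ' hdim).leviCivita u) Z₀ =
      g.val (Φ u) (deTurckField g g.leviCivita h.leviCivita (Φ u)) (mfderiv I' I Φ u Z₀) := by
  have hinv : (mfderiv I' I Φ u).IsInvertible := isInvertible_mfderiv_of_injective hdim (hΦ' u)
  rw [deTurckField, deTurckField, val_traceVec, val_traceVec]
  refine trace_comap_eq g hpb hΦ hΦ' hdim u _ _ fun v w ↦ ?_
  rw [bilinFormOfVec_apply, bilinFormOfVec_apply, difference_comap_apply g h hpb hΦ hΦ' hdim,
    val_comap, pullbackBilin_apply, hinv.self_apply_inverse]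

omit [CompleteSpace E] in
include hΦ' in
/-- **Naturality of the DeTurck vector field under local diffeomorphisms**: the DeTurck field of
the pulled-back pair `(Φ^*g, Φ^*h)` is the pullback of the DeTurck field of `(g, h)`,
`W'_u = (dΦ_u)⁻¹ W_{Φ u}` ("as it is the difference of two connections, it is a globally well
defined vector field", Andrews–Hopper 2011, §5.4.1; diffeomorphism invariance).
[cite: AndrewsHopper2011, §5.4.1, (5.7)] -/
theorem deTurckField_comap [g.HasLeviCivita] [h.HasLeviCivita]
    [(g.comap hpb Φ hΦ hΦ' hdim).HasLeviCivita] [(h.comap hpb Φ hΦ hΦ' hdim).HasLeviCivita]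
    (u : N) :
    deTurckField (g.comap hpb Φ hΦ hΦ' hdim) (g.comap hpb Φ hΦ hΦ' hdim).leviCivita
        (h.comap hpb Φ hΦ hΦ' hdim).leviCivita u =
      mpullback I' I Φ (deTurckField g g.leviCivita h.leviCivita) u := by
  have hinv : (mfderiv I' I Φ u).IsInvertible := isInvertible_mfderiv_of_injective hdim (hΦ' u)
  rw [mpullback_apply]
  refine sub_eq_zero.1 ((g.comap hpb Φ hΦ hΦ' hdim).nondegenerate u _ fun w ↦ ?_)
  rw [map_sub, _root_.sub_apply, val_deTurckField_comap g h hpb hΦ hΦ' hdim u w, val_comap,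
    pullbackBilin_apply, hinv.self_apply_inverse, sub_self]

omit [CompleteSpace E] [CompleteSpace E'] in
include hΦ' in
/-- **Naturality of the Lie derivative term**: for a vector field `W` on `M` differentiable at
`Φ u`, `ℒ_{Φ^*W} (Φ^*g) (X₀, Y₀) = (ℒ_W g)(dΦ X₀, dΦ Y₀)` at `u`, both written through the
Levi-Civita connections (`lieDerivMetric`; `leviCivita_comap_mpullback_apply`).
[cite: ONeill1983, Ch. 3, Prop. 3.59] -/
theorem lieDerivMetric_comap_mpullback [g.HasLeviCivita]
    [(g.comap hpb Φ hΦ hΦ' hdim).HasLeviCivita] {u : N} {W : Π x : M, TangentSpace I x}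
    (hW : MDiffAt (T% W) (Φ u)) (X₀ Y₀ : TangentSpace I' u) :
    lieDerivMetric (g.comap hpb Φ hΦ hΦ' hdim) (g.comap hpb Φ hΦ hΦ' hdim).leviCivita
        (mpullback I' I Φ W) u X₀ Y₀ =
      lieDerivMetric g g.leviCivita W (Φ u) (mfderiv I' I Φ u X₀) (mfderiv I' I Φ u Y₀) := by
  have hinv : (mfderiv I' I Φ u).IsInvertible := isInvertible_mfderiv_of_injective hdim (hΦ' u)
  rw [lieDerivMetric, lieDerivMetric, g.leviCivita_comap_mpullback_apply hpb hΦ hΦ' hdim hW X₀,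
    g.leviCivita_comap_mpullback_apply hpb hΦ hΦ' hdim hW Y₀, val_comap, pullbackBilin_apply,
    pullbackBilin_apply, hinv.self_apply_inverse, hinv.self_apply_inverse]

include hΦ' in
/-- **Naturality of the Ricci–DeTurck operator under local diffeomorphisms** (diffeomorphism
invariance of `g ↦ -2 Ric(g) + ℒ_{W(g, h)} g` for the pair `(g, h)`; Andrews–Hopper 2011, §5.4,
(5.10); Topping 2006, §5.2): if the DeTurck field `W` of `(g, h)` is differentiable at `Φ u`, then
`-2 Ric_{Φ^*g}(X₀, Y₀) + ℒ_{W'} (Φ^*g)(X₀, Y₀) = -2 Ric_g(dΦ X₀, dΦ Y₀) + (ℒ_W g)(dΦ X₀, dΦ Y₀)`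
at `u`, where `W'` is the DeTurck field of `(Φ^*g, Φ^*h)` (`ricci_comap_apply`,
`deTurckField_comap`, `lieDerivMetric_comap_mpullback`).
[cite: AndrewsHopper2011, §5.4.2, (5.10)] [cite: ONeill1983, Ch. 3, Prop. 3.59] -/
theorem rdt_rhs_comap [g.HasLeviCivita] [h.HasLeviCivita]
    [(g.comap hpb Φ hΦ hΦ' hdim).HasLeviCivita] [(h.comap hpb Φ hΦ hΦ' hdim).HasLeviCivita]
    {u : N} (hW : MDiffAt (T% (deTurckField g g.leviCivita h.leviCivita)) (Φ u))
    (X₀ Y₀ : TangentSpace I' u) :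
    -2 * (g.comap hpb Φ hΦ hΦ' hdim).ricci u X₀ Y₀ +
        lieDerivMetric (g.comap hpb Φ hΦ hΦ' hdim) (g.comap hpb Φ hΦ hΦ' hdim).leviCivita
          (deTurckField (g.comap hpb Φ hΦ hΦ' hdim) (g.comap hpb Φ hΦ hΦ' hdim).leviCivita
            (h.comap hpb Φ hΦ hΦ' hdim).leviCivita) u X₀ Y₀ =
      -2 * g.ricci (Φ u) (mfderiv I' I Φ u X₀) (mfderiv I' I Φ u Y₀) +
        lieDerivMetric g g.leviCivita (deTurckField g g.leviCivita h.leviCivita) (Φ u)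
          (mfderiv I' I Φ u X₀) (mfderiv I' I Φ u Y₀) := by
  have hWeq : deTurckField (g.comap hpb Φ hΦ hΦ' hdim) (g.comap hpb Φ hΦ hΦ' hdim).leviCivita
      (h.comap hpb Φ hΦ hΦ' hdim).leviCivita =
      mpullback I' I Φ (deTurckField g g.leviCivita h.leviCivita) :=
    funext fun u ↦ deTurckField_comap g h hpb hΦ hΦ' hdim u
  rw [g.ricci_comap_apply hpb hΦ hΦ' hdim u X₀ Y₀, hWeq,
    lieDerivMetric_comap_mpullback g hpb hΦ hΦ' hdim hW X₀ Y₀]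

/-! ### Independence of the Levi-Civita witnesses -/

/-- The difference tensor with a Levi-Civita background does not depend on the choice of the
background witness: two torsion-free `h`-compatible connections agree on differentiable (in
particular extended) sections (`IsLeviCivita.eq_leviCivita_holds`). [folklore] -/
theorem difference_eq_of_isLeviCivita_right [h.HasLeviCivita]
    (cov : CovariantDerivative I E (TangentSpace I : M → Type _))
    {bg bg' : CovariantDerivative I E (TangentSpace I : M → Type _)}
    (hbg : h.IsLeviCivita bg) (hbg' : h.IsLeviCivita bg') (x : M) :
    cov.difference bg x = cov.difference bg' x := by
  ext Y₀ X₀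
  have hY : MDiffAt (T% (FiberBundle.extend E Y₀)) x := mdifferentiableAt_extend I E Y₀
  have h₁ := IsCovariantDerivativeOn.difference_apply (x := x) cov.isCovariantDerivativeOnUniv
    bg.isCovariantDerivativeOnUniv (σ := FiberBundle.extend E Y₀) (by trivial) hY
  have h₂ := IsCovariantDerivativeOn.difference_apply (x := x) cov.isCovariantDerivativeOnUniv
    bg'.isCovariantDerivativeOnUniv (σ := FiberBundle.extend E Y₀) (by trivial) hY
  simp only [FiberBundle.extend_apply_self] at h₁ h₂
  change (cov.isCovariantDerivativeOnUniv.difference bg.isCovariantDerivativeOnUniv x) Y₀ X₀ =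
    (cov.isCovariantDerivativeOnUniv.difference bg'.isCovariantDerivativeOnUniv x) Y₀ X₀
  rw [h₁, h₂, IsLeviCivita.eq_leviCivita_holds (g := h) hbg hY,
    IsLeviCivita.eq_leviCivita_holds (g := h) hbg' hY]

/-- **The Ricci–DeTurck right-hand side does not depend on the Levi-Civita witnesses**: for
`cov` a Levi-Civita connection of `g` and `bg` one of `h`, at a point where the DeTurck field is
differentiable, `-2 Ric(cov) + ℒ_{W(g,cov,bg)} g` (through `cov`, as in
`IsRicciDeTurckFlow.hasDerivWithinAt`) equals the same expression written with `g.leviCivita`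
and `h.leviCivita` (`IsLeviCivita.ricci_eq_ricci`, `deTurckField_eq_of_isLeviCivita`,
`difference_eq_of_isLeviCivita_right`, `IsLeviCivita.eq_leviCivita_holds`). [folklore] -/
theorem rdt_rhs_eq_of_isLeviCivita [g.HasLeviCivita] [h.HasLeviCivita]
    {cov bg : CovariantDerivative I E (TangentSpace I : M → Type _)}
    (hcov : g.IsLeviCivita cov) (hbg : h.IsLeviCivita bg) {x : M}
    (hW : MDiffAt (T% (deTurckField g g.leviCivita h.leviCivita)) x) (X₀ Y₀ : TangentSpace I x) :
    -2 * cov.ricci x X₀ Y₀ + lieDerivMetric g cov (deTurckField g cov bg) x X₀ Y₀ =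
      -2 * g.ricci x X₀ Y₀ +
        lieDerivMetric g g.leviCivita (deTurckField g g.leviCivita h.leviCivita) x X₀ Y₀ := by
  have h2 : (2 : ℕ∞ω) ≤ ∞ := WithTop.coe_le_coe.mpr le_top
  have hW₁ : deTurckField g cov bg = deTurckField g g.leviCivita bg :=
    deTurckField_eq_of_isLeviCivita hcov g.isLeviCivita_leviCivita_holds
  have hW₂ : deTurckField g g.leviCivita bg = deTurckField g g.leviCivita h.leviCivita := by
    funext y
    simp only [deTurckField,
      difference_eq_of_isLeviCivita_right h g.leviCivita hbg h.isLeviCivita_leviCivita_holds y]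
  have hric : cov.ricci x = g.ricci x := hcov.ricci_eq_ricci h2 x
  have hcovW : cov (deTurckField g g.leviCivita h.leviCivita) x =
      g.leviCivita (deTurckField g g.leviCivita h.leviCivita) x :=
    IsLeviCivita.eq_leviCivita_holds (g := g) hcov hW
  rw [hric, hW₁, hW₂, lieDerivMetric, lieDerivMetric, hcovW]

end Naturality

/-! ### The inverse extended chart as a local diffeomorphism from an open subset of `E` -/

section Chart

variable {E : Type*} [NormedAddCommGroup E] [NormedSpace ℝ E] {H : Type*} [TopologicalSpace H]
  {I : ModelWithCorners ℝ E H} [I.Boundaryless] {M : Type*} [TopologicalSpace M]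
  [ChartedSpace H M] [IsManifold I ∞ M]

variable (I) in
/-- The target of the extended chart at `x₁` as an open subset of the model vector space `E`
(boundaryless model; Mathlib's `isOpen_extChartAt_target`), regarded below as a manifold modelled
on `𝓘(ℝ, E)` (`TopologicalSpace.Opens.instChartedSpace`). [folklore] -/
def chartTarget (x₁ : M) : Opens E :=
  ⟨(extChartAt I x₁).target, isOpen_extChartAt_target x₁⟩

variable (I) in
/-- **The inverse extended chart** `Φ = (extChartAt I x₁)⁻¹ : chartTarget I x₁ → M`, a smooth
local diffeomorphism from an open subset of `E` onto the chart domain of `x₁` — the map along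
which metrics on `M` are read "in the coordinates of the chart at `x₁`" (O'Neill 1983, Ch. 3,
pp. 90–91: a local diffeomorphism pulls back the metric to a local isometry). [folklore] -/
def chartInv (x₁ : M) : chartTarget I x₁ → M := fun u ↦ (extChartAt I x₁).symm u

omit [I.Boundaryless] [IsManifold I ∞ M] in
/-- `chartInv` unfolds to the inverse extended chart. [folklore] -/
theorem chartInv_apply [I.Boundaryless] (x₁ : M) (u : chartTarget I x₁) :
    chartInv I x₁ u = (extChartAt I x₁).symm u := rfl

omit [IsManifold I ∞ M] in
/-- The points of `chartTarget` lie in the target of the extended chart. [folklore] -/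
theorem coe_mem_target (x₁ : M) (u : chartTarget I x₁) : (u : E) ∈ (extChartAt I x₁).target :=
  u.2

omit [IsManifold I ∞ M] in
/-- `chartInv` takes values in the chart domain. [folklore] -/
theorem chartInv_mem_source (x₁ : M) (u : chartTarget I x₁) :
    chartInv I x₁ u ∈ (chartAt H x₁).source := by
  rw [← extChartAt_source I]
  exact (extChartAt I x₁).map_target u.2

omit [IsManifold I ∞ M] in
/-- The extended chart is a left inverse of `chartInv`. [folklore] -/
theorem extChartAt_chartInv (x₁ : M) (u : chartTarget I x₁) :
    extChartAt I x₁ (chartInv I x₁ u) = u :=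
  (extChartAt I x₁).right_inv u.2

omit [IsManifold I ∞ M] in
/-- `chartInv` is a right inverse of the extended chart on the chart domain. [folklore] -/
theorem chartInv_extChartAt (x₁ : M) {x : M} (hx : x ∈ (chartAt H x₁).source) :
    chartInv I x₁ ⟨extChartAt I x₁ x, (extChartAt I x₁).map_source
      (by rwa [extChartAt_source])⟩ = x :=
  (extChartAt I x₁).left_inv (by rwa [extChartAt_source])

/-- **`chartInv` is smooth** (`contMDiffOn_extChartAt_symm`), in the form `C^{∞ + 1}` required
by `PseudoRiemannianMetric.comap`. [folklore] -/
theorem contMDiff_chartInv (x₁ : M) : ContMDiff 𝓘(ℝ, E) I (∞ + 1) (chartInv I x₁) := by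
  have h : ((∞ : ℕ∞ω) + 1) = ∞ := rfl
  rw [h]
  intro u
  change ContMDiffAt 𝓘(ℝ, E) I ∞ (fun u : chartTarget I x₁ ↦ (extChartAt I x₁).symm u) u
  rw [contMDiffAt_subtype_iff (U := chartTarget I x₁) (f := (extChartAt I x₁).symm)]
  exact (contMDiffOn_extChartAt_symm x₁).contMDiffAt
    ((isOpen_extChartAt_target x₁).mem_nhds u.2)

/-- The differential of `chartInv` composed with that of the extended chart is the identity:
`D(extChartAt) ∘ D(chartInv) = id` at every point of the target. [folklore] -/
theorem mfderiv_extChartAt_comp_mfderiv_chartInv (x₁ : M) (u : chartTarget I x₁) :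
    (mfderiv I 𝓘(ℝ, E) (extChartAt I x₁) (chartInv I x₁ u)).comp
        (mfderiv 𝓘(ℝ, E) I (chartInv I x₁) u) = ContinuousLinearMap.id ℝ _ := by
  have hΦd : MDifferentiableAt 𝓘(ℝ, E) I (chartInv I x₁) u :=
    ((contMDiff_chartInv x₁).of_le le_self_add u).mdifferentiableAt (by simp)
  have hψd : MDifferentiableAt I 𝓘(ℝ, E) (extChartAt I x₁) (chartInv I x₁ u) :=
    mdifferentiableAt_extChartAt (chartInv_mem_source x₁ u)
  have hcomp := mfderiv_comp u hψd hΦd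
  -- `extChartAt ∘ chartInv = Subtype.val` on the open manifold `chartTarget`
  have hid : (extChartAt I x₁) ∘ chartInv I x₁ = (Subtype.val : chartTarget I x₁ → E) := by
    funext v
    exact extChartAt_chartInv x₁ v
  rw [hid] at hcomp
  rw [← hcomp]
  have hval : mfderiv 𝓘(ℝ, E) 𝓘(ℝ, E) (Subtype.val : chartTarget I x₁ → E) u =
      ContinuousLinearMap.id ℝ E := by
    have h := OpensChart.mfderiv_extChartAt_apply (U := chartTarget I x₁) u
    ext v
    rw [← OpensChart.extChartAt_coe u]
    exact OpensChart.mfderiv_extChartAt_apply u v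
  exact hval

/-- **`chartInv` is an immersion**: all its differentials are injective (it has the smooth left
inverse `extChartAt I x₁`). [folklore] -/
theorem injective_mfderiv_chartInv (x₁ : M) (u : chartTarget I x₁) :
    Function.Injective (mfderiv 𝓘(ℝ, E) I (chartInv I x₁) u) := by
  have h := mfderiv_extChartAt_comp_mfderiv_chartInv x₁ u
  intro v w hvw
  have := congrArg (mfderiv I 𝓘(ℝ, E) (extChartAt I x₁) (chartInv I x₁ u)) hvw
  rw [← ContinuousLinearMap.comp_apply, ← ContinuousLinearMap.comp_apply, h] at this
  exact this

/-- `D(extChartAt)_{Φ u} (D(chartInv)_u v) = v`. [folklore] -/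
theorem mfderiv_extChartAt_chartInv_apply (x₁ : M) (u : chartTarget I x₁)
    (v : TangentSpace 𝓘(ℝ, E) u) :
    mfderiv I 𝓘(ℝ, E) (extChartAt I x₁) (chartInv I x₁ u)
      (mfderiv 𝓘(ℝ, E) I (chartInv I x₁) u v) = v := by
  have h := mfderiv_extChartAt_comp_mfderiv_chartInv x₁ u
  have h' := DFunLike.congr_fun h v
  rw [ContinuousLinearMap.comp_apply] at h'
  exact h'

omit [I.Boundaryless] in
/-- **A vector field is differentiable at a point of the chart domain as soon as its chart
representative is**: if near `x` the field `W` read through the differential of the extended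
chart at `x₁`, `y ↦ D(extChartAt I x₁)_y (W y)`, agrees with `Wf ∘ extChartAt I x₁` for a map
`Wf : E → E` differentiable at `extChartAt I x₁ x`, then `W` is a differentiable section of `TM`
at `x` (Mathlib's `Trivialization.mdifferentiableAt_section_iff` for the trivialization of `TM`
at `x₁`, which reads vectors through `D(extChartAt I x₁)`,
`TangentBundle.continuousLinearMapAt_trivializationAt`). [folklore] -/
theorem mdifferentiableAt_section_of_chartRepr (x₁ : M) {W : Π x : M, TangentSpace I x} {x : M}
    (hx : x ∈ (chartAt H x₁).source) {Wf : E → E}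
    (hWf : ∀ᶠ y in 𝓝 x, (mfderiv I 𝓘(ℝ, E) (extChartAt I x₁) y (W y) : E) =
      Wf (extChartAt I x₁ y))
    (hd : DifferentiableAt ℝ Wf (extChartAt I x₁ x)) : MDiffAt (T% W) x := by
  have hxe : x ∈ (trivializationAt E (TangentSpace I : M → Type _) x₁).baseSet := by
    simpa using hx
  rw [(trivializationAt E (TangentSpace I : M → Type _) x₁).mdifferentiableAt_section_iff I W hxe]
  have heq : (fun y ↦ ((trivializationAt E (TangentSpace I : M → Type _) x₁) ⟨y, W y⟩).2)
      =ᶠ[𝓝 x] fun y ↦ Wf (extChartAt I x₁ y) := by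
    filter_upwards [hWf, (chartAt H x₁).open_source.mem_nhds hx] with y hy hy'
    have hye : y ∈ (trivializationAt E (TangentSpace I : M → Type _) x₁).baseSet := by
      simpa using hy'
    rw [← Trivialization.continuousLinearMapAt_apply_of_mem (R := ℝ) _ hye, ← hy]
    exact DFunLike.congr_fun (TangentBundle.continuousLinearMapAt_trivializationAt hy') (W y)
  refine MDifferentiableAt.congr_of_eventuallyEq ?_ heq
  exact (mdifferentiableAt_iff_differentiableAt.2 hd).comp x (mdifferentiableAt_extChartAt hx)

/-! ### Metrics read in a chart: the pullback along `chartInv` -/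

section Pullback

variable [FiniteDimensional ℝ E] [CompleteSpace E]

variable (I) in
/-- **A metric read in the chart at `x₁`**: the pullback `Φ^* g` of a smooth metric `g` on `TM`
along the inverse extended chart `Φ = chartInv I x₁`, a smooth metric on the open subset
`chartTarget I x₁` of `E` (`PseudoRiemannianMetric.comap` with the smoothness of pullbacks
`contMDiff_pullbackBilin_holds`, `contMDiff_chartInv`, `injective_mfderiv_chartInv`).
O'Neill 1983, Ch. 3, pp. 90–91. [cite: ONeill1983, Ch. 3, pp. 90–91] -/
abbrev chartPullback (g : PseudoRiemannianMetric I ∞ E (TangentSpace I : M → Type _)) (x₁ : M) :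
    PseudoRiemannianMetric 𝓘(ℝ, E) ∞ E (TangentSpace 𝓘(ℝ, E) : chartTarget I x₁ → Type _) :=
  g.comap contMDiff_pullbackBilin_holds (chartInv I x₁) (contMDiff_chartInv x₁)
    (injective_mfderiv_chartInv x₁) rfl

omit [CompleteSpace E] in
/-- The metric read in the chart, evaluated: `(Φ^*g)_u (v, w) = g_{Φ u}(dΦ v, dΦ w)`. [folklore] -/
theorem val_chartPullback_apply (g : PseudoRiemannianMetric I ∞ E (TangentSpace I : M → Type _))
    (x₁ : M) (u : chartTarget I x₁) (v w : TangentSpace 𝓘(ℝ, E) u) :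
    (chartPullback I g x₁).val u v w =
      g.val (chartInv I x₁ u) (mfderiv 𝓘(ℝ, E) I (chartInv I x₁) u v)
        (mfderiv 𝓘(ℝ, E) I (chartInv I x₁) u w) :=
  rfl

omit [CompleteSpace E] in
/-- A metric positive definite at `Φ u` reads as a metric positive definite at `u` (`dΦ_u` is
injective). [folklore] -/
theorem chartPullback_pos (g : PseudoRiemannianMetric I ∞ E (TangentSpace I : M → Type _))
    (x₁ : M) (u : chartTarget I x₁)
    (hpos : ∀ v : TangentSpace I (chartInv I x₁ u), v ≠ 0 → 0 < g.val (chartInv I x₁ u) v v)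
    (v : TangentSpace 𝓘(ℝ, E) u) (hv : v ≠ 0) : 0 < (chartPullback I g x₁).val u v v := by
  rw [val_chartPullback_apply]
  refine hpos _ fun h0 ↦ hv ?_
  exact injective_mfderiv_chartInv x₁ u (by rw [h0, map_zero])

omit [CompleteSpace E] in
/-- The square norm of a bilinear form read in the chart is its square norm:
`|Φ^*T|²_{Φ^*g}(u) = |T|²_g(Φ u)` for `(Φ^*T)(v, w) = T(dΦ v, dΦ w)` (`normSq_comap_eq`).
[cite: ONeill1983, Ch. 3, Prop. 3.59] -/
theorem normSq_chartPullback_eq (g : PseudoRiemannianMetric I ∞ E (TangentSpace I : M → Type _))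
    (x₁ : M) (u : chartTarget I x₁) (B' : LinearMap.BilinForm ℝ (TangentSpace 𝓘(ℝ, E) u))
    (B : LinearMap.BilinForm ℝ (TangentSpace I (chartInv I x₁ u)))
    (hB : ∀ v w, B' v w =
      B (mfderiv 𝓘(ℝ, E) I (chartInv I x₁) u v) (mfderiv 𝓘(ℝ, E) I (chartInv I x₁) u w)) :
    (chartPullback I g x₁).normSq u B' = g.normSq (chartInv I x₁ u) B :=
  normSq_comap_eq g contMDiff_pullbackBilin_holds (contMDiff_chartInv x₁)
    (injective_mfderiv_chartInv x₁) rfl u B' B hB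

omit [CompleteSpace E] in
/-- The metric trace of a bilinear form read in the chart is its metric trace
(`trace_comap_eq`). [cite: ONeill1983, Ch. 3, Prop. 3.59] -/
theorem trace_chartPullback_eq (g : PseudoRiemannianMetric I ∞ E (TangentSpace I : M → Type _))
    (x₁ : M) (u : chartTarget I x₁) (B' : LinearMap.BilinForm ℝ (TangentSpace 𝓘(ℝ, E) u))
    (B : LinearMap.BilinForm ℝ (TangentSpace I (chartInv I x₁ u)))
    (hB : ∀ v w, B' v w =
      B (mfderiv 𝓘(ℝ, E) I (chartInv I x₁) u v) (mfderiv 𝓘(ℝ, E) I (chartInv I x₁) u w)) :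
    (chartPullback I g x₁).trace u B' = g.trace (chartInv I x₁ u) B :=
  trace_comap_eq g contMDiff_pullbackBilin_holds (contMDiff_chartInv x₁)
    (injective_mfderiv_chartInv x₁) rfl u B' B hB

/-- **The Ricci–DeTurck equation read in a chart.** Let `(k, cov)` be a Ricci–DeTurck flow on the
time set `S` relative to a background `bg` that is a Levi-Civita connection of a smooth metric
`h` (`IsRicciDeTurckFlow`, `RicciDeTurckFlow.lean`). Then at every point `u` of the chart target
at `x₁` where the DeTurck field `W_t` of `(k t, h)` is differentiable (at `Φ u`), the metrics read
in the chart, `Φ^*(k s)`, satisfy the Ricci–DeTurck equation of the pulled-back pair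
`(Φ^*(k t), Φ^*h)` at `u`:
`d/ds (Φ^*k s)_u(X₀, Y₀) = -2 Ric_{Φ^*k t}(X₀, Y₀) + ℒ_{W'_t}(Φ^*k t)(X₀, Y₀)` within `S` at `t`
(diffeomorphism invariance of the Ricci–DeTurck operator, `rdt_rhs_comap`, and independence of
the Levi-Civita witnesses, `rdt_rhs_eq_of_isLeviCivita`). [cite: AndrewsHopper2011, §5.4.2, (5.10)] -/
theorem IsRicciDeTurckFlow.hasDerivWithinAt_chartPullback
    {k : ℝ → PseudoRiemannianMetric I ∞ E (TangentSpace I : M → Type _)}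
    {cov : ℝ → CovariantDerivative I E (TangentSpace I : M → Type _)}
    {bg : CovariantDerivative I E (TangentSpace I : M → Type _)} {S : Set ℝ}
    (hk : IsRicciDeTurckFlow k cov bg S)
    {h : PseudoRiemannianMetric I ∞ E (TangentSpace I : M → Type _)} (hbg : h.IsLeviCivita bg)
    (x₁ : M) {t : ℝ} (ht : t ∈ S) [(k t).HasLeviCivita] [h.HasLeviCivita]
    [(chartPullback I (k t) x₁).HasLeviCivita] [(chartPullback I h x₁).HasLeviCivita]
    (u : chartTarget I x₁)
    (hW : MDiffAt (T% (deTurckField (k t) (k t).leviCivita h.leviCivita)) (chartInv I x₁ u))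
    (X₀ Y₀ : TangentSpace 𝓘(ℝ, E) u) :
    HasDerivWithinAt (fun s : ℝ ↦ (chartPullback I (k s) x₁).val u X₀ Y₀)
      (-2 * (chartPullback I (k t) x₁).ricci u X₀ Y₀ +
        lieDerivMetric (chartPullback I (k t) x₁) (chartPullback I (k t) x₁).leviCivita
          (deTurckField (chartPullback I (k t) x₁) (chartPullback I (k t) x₁).leviCivita
            (chartPullback I h x₁).leviCivita) u X₀ Y₀) S t := by
  have hfun : (fun s : ℝ ↦ (chartPullback I (k s) x₁).val u X₀ Y₀) = fun s ↦
      (k s).val (chartInv I x₁ u) (mfderiv 𝓘(ℝ, E) I (chartInv I x₁) u X₀)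
        (mfderiv 𝓘(ℝ, E) I (chartInv I x₁) u Y₀) := by
    funext s
    exact val_chartPullback_apply (k s) x₁ u X₀ Y₀
  rw [hfun]
  dsimp only [chartPullback]
  rw [rdt_rhs_comap (k t) h contMDiff_pullbackBilin_holds (contMDiff_chartInv x₁)
      (injective_mfderiv_chartInv x₁) rfl hW X₀ Y₀,
    ← rdt_rhs_eq_of_isLeviCivita (k t) h (hk.isLeviCivita t ht) hbg hW]
  exact hk.hasDerivWithinAt t ht (chartInv I x₁ u) _ _

end Pullback

end Chart

end Literature.Geometry.Riemannian

end
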